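import Literature.RingTheory.MvPolynomial.KaltofenScaledNewtonProofs
import HarnessLib

/-!
# Kaltofen's absolute irreducibility test, II: the linear system (29) and functoriality

Proofs about the objects of `KaltofenTestDefs` (E. Kaltofen, J. Comput. System Sci. 50 (1995)
274–295, §2 Step L, §3 eq. (27), (29)):

* `alphaSharp_pow`: `(z̄ + ρδ̄)ⁱ = z̄ⁱ + ρ A_i` (recursion (27));
* `coeff_eval_smallPoly_sharp`: the `Y^k`-coefficient of `h_w(α♯)` (scaled variables) is
  `ρ^{[k≠0]} Σ_c w_c E_k(c)`, with `E_k` the entries `entryR` of (29); `kMatrix_mulVec`: the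
  matrix computes the `z̄ʲ`-coordinates of that sum;
* `kMatrix_mulVec_eq_zero_iff_sharp` / `kMatrix_mulVec_eq_zero_iff`: **Kaltofen's system**
  `M w = 0 ⟺ h_w(α) ≡ 0 (mod y^{ℓ+1})` (any ring with `ρ` a unit, resp. a field with `ρ ≠ 0`,
  back in the true variable `y = ρ²Y` via `alphaTrue`), and `X_pow_dvd_eval_alphaTrue`:
  `P(α_K, y) ≡ 0 (mod y^{K+1})`;
* functoriality of every object under base change `φ : A → B` (`rres_mapP`, `cofPoly_mapP` via
  an explicit coefficient formula for `adjSylvester`, `spec_*`, `deltaBar_mapP`, …,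
  `kMatrix_mapP : M(φP) = φ(M(P))`) — the point of having defined everything division-free and
  choice-free: the integer forms specialise to the matrix of every specific polynomial.

No definitions, no named facts.

## References

* E. Kaltofen, J. Comput. System Sci. 50 (1995) 274–295, §2 Step L, §3 (27), (29). [Kaltofen1995]
-/

noncomputable section

open Polynomial

namespace Literature.RingTheory.MvPolynomial.KaltofenAIT

universe u v

variable {A : Type u} [CommRing A]

/-! ### Powers of the scaled root and the entries of Kaltofen's matrix (29) -/

section Matrix29

variable (P : Polynomial A[X]) (d e K : ℕ)

/-- `(z̄ + ρ δ̄)ⁱ = z̄ⁱ + ρ A_i`. [cite: Kaltofen1995, §3 eq. (27)] -/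
theorem alphaSharp_pow (i : ℕ) :
    alphaSharp P d e K ^ i = C (zbar P ^ i) + C (rhoR P d) * powA P d e K i := by
  induction i with
  | zero => simp [powA]
  | succ i ih =>
    rw [pow_succ, ih, powA, alphaSharp, pow_succ, C_mul]
    ring

/-- `Y ∣ A_i` (since `Y ∣ δ̄`). [folklore] -/
theorem X_dvd_powA (i : ℕ) : (X : (Rt P)[X]) ∣ powA P d e K i := by
  induction i with
  | zero => exact dvd_zero _
  | succ i ih =>
    rw [powA]
    have hδ := (deltaBar_spec P d e K).1
    exact dvd_add (dvd_add (ih.mul_left _) (hδ.mul_left _)) ((hδ.mul_left _).mul_right _)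

variable {P d e K}

/-- One column: the `Y^k`-coefficient of `(w z̄^ι (ρ²Y)ˡ xⁱ)(α♯)` is `ρ^{[k ≠ 0]} w E_k(i,l,ι)`.
[cite: Kaltofen1995, §3 (derivation of (29))] -/
theorem coeff_eval_column (a : Rt P) (i l ι k : ℕ) :
    ((C (C (a * zbar P ^ ι) * (C (rhoR P d ^ 2) * X) ^ l) * X ^ i).eval (alphaSharp P d e K)).coeff k
      = (if k = 0 then 1 else rhoR P d) * (a * entryR P d e K k (i, l, ι)) := by
  have hA0 : (powA P d e K i).coeff 0 = 0 := by
    obtain ⟨q, hq⟩ := X_dvd_powA P d e K i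
    rw [hq, coeff_X_mul_zero]
  rw [eval_mul, eval_pow, eval_X, eval_C, alphaSharp_pow, mul_pow, ← C_pow, mul_add]
  rw [show C (a * zbar P ^ ι) * (C ((rhoR P d ^ 2) ^ l) * X ^ l) * C (zbar P ^ i) =
      C (a * zbar P ^ ι * (rhoR P d ^ 2) ^ l * zbar P ^ i) * X ^ l by
        simp only [C_mul]; ring,
    show C (a * zbar P ^ ι) * (C ((rhoR P d ^ 2) ^ l) * X ^ l) * (C (rhoR P d) * powA P d e K i) =
      C (a * zbar P ^ ι * (rhoR P d ^ 2) ^ l * rhoR P d) * (X ^ l * powA P d e K i) by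
        simp only [C_mul]; ring]
  rw [coeff_add, coeff_C_mul, coeff_C_mul, coeff_X_pow, coeff_X_pow_mul', entryR]
  dsimp only
  rcases Nat.lt_trichotomy l k with hlk | rfl | hlk
  · -- `l < k`: only the `A_i` term
    rw [if_neg (ne_of_gt hlk), if_pos hlk.le, if_pos hlk, if_neg (by omega : k ≠ 0), mul_zero, zero_add,
      ← pow_mul]
    ring
  · -- `l = k`
    rw [if_pos rfl, if_pos le_rfl, if_neg (lt_irrefl l), if_pos rfl, Nat.sub_self, hA0, mul_zero,
      add_zero, mul_one, ← pow_mul]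
    rcases Nat.eq_zero_or_pos l with rfl | hl
    · simp only [if_true, mul_zero, pow_zero, one_mul, mul_one]
      ring
    · rw [if_neg hl.ne']
      have : rhoR P d * rhoR P d ^ (2 * l - 1) = rhoR P d ^ (2 * l) := by
        rw [← pow_succ', Nat.sub_add_cancel (by omega)]
      rw [pow_add, ← this]
      ring
  · -- `l > k`: nothing
    rw [if_neg (ne_of_lt hlk), if_neg (not_le.2 hlk), if_neg (not_lt.2 hlk.le), if_neg (ne_of_gt hlk)]
    simp

/-- `y ↦ ρ² y` on a monomial column. [folklore] -/
theorem scaleY_column (a : Rt P) (l ι : ℕ) :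
    scaleY P d (C (a * zbar P ^ ι) * X ^ l) = C (a * zbar P ^ ι) * (C (rhoR P d ^ 2) * X) ^ l := by
  rw [coe_compRingHom_apply, mul_comp, C_comp, X_pow_comp]

/-- **The `Y^k`-coefficient of `h_w(α♯)` (scaled variables) is `ρ^{[k≠0]} · Σ_c w_c E_k(c)`.**
[cite: Kaltofen1995, §3 (derivation of (29))] -/
theorem coeff_eval_smallPoly_sharp (w : Fin d × Fin (e + 1) × Fin d → A) (k : ℕ) :
    (((smallPoly P d e w).map (scaleY P d)).eval (alphaSharp P d e K)).coeff k =
      (if k = 0 then 1 else rhoR P d) *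
        ∑ c, algebraMap A (Rt P) (w c) * entryR P d e K k ((c.1 : ℕ), (c.2.1 : ℕ), (c.2.2 : ℕ)) := by
  rw [smallPoly, Polynomial.map_sum, eval_finsetSum, finsetSum_coeff, Finset.mul_sum]
  refine Finset.sum_congr rfl fun c _ => ?_
  rw [Polynomial.map_mul, Polynomial.map_pow, map_X, map_C, scaleY_column, coeff_eval_column]

/-- The matrix (29) computes the `z̄ʲ`-coordinates of `Σ_c w_c E_k(c)`. [cite: Kaltofen1995, §3 eq. (29)] -/
theorem kMatrix_mulVec (hm : (red P).Monic) (ℓ : ℕ) (w : Fin d × Fin (e + 1) × Fin d → A)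
    (r : Fin (ℓ + 1) × Fin d) :
    (kMatrix P d e K hm ℓ).mulVec w r = (AdjoinRoot.modByMonicHom hm
      (∑ c, algebraMap A (Rt P) (w c) *
        entryR P d e K r.1 ((c.1 : ℕ), (c.2.1 : ℕ), (c.2.2 : ℕ)))).coeff r.2 := by
  rw [Matrix.mulVec, dotProduct, map_sum, finsetSum_coeff]
  refine Finset.sum_congr rfl fun c _ => ?_
  rw [kMatrix, ← Algebra.smul_def, LinearMap.map_smul, coeff_smul, smul_eq_mul, mul_comm]

/-- Coordinates detect `0`: an element of `R = A[z]/(P₀)` (`P₀` monic of degree `d`) vanishes iff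
its `z̄ʲ`-coordinates, `j < d`, vanish. [folklore] -/
theorem eq_zero_iff_coeff_modByMonicHom (hm : (red P).Monic) (hdeg : (red P).natDegree = d)
    (u : Rt P) : u = 0 ↔ ∀ j : Fin d, (AdjoinRoot.modByMonicHom hm u).coeff j = 0 := by
  constructor
  · rintro rfl j
    rw [LinearMap.map_zero, coeff_zero]
  · intro h
    obtain ⟨p, rfl⟩ := AdjoinRoot.mk_surjective u
    rw [AdjoinRoot.modByMonicHom_mk] at h
    nontriviality A
    have hp : p %ₘ red P = 0 := by
      ext j
      rw [coeff_zero]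
      by_cases hj : j < d
      · exact h ⟨j, hj⟩
      · by_cases h1 : red P = 1
        · rw [h1, modByMonic_one, coeff_zero]
        · refine coeff_eq_zero_of_natDegree_lt ?_
          have := natDegree_modByMonic_lt p hm h1
          omega
    rw [← (AdjoinRoot.mk_leftInverse hm) (AdjoinRoot.mk (red P) p), AdjoinRoot.modByMonicHom_mk, hp,
      map_zero]

/-- **Kaltofen's linear system, scaled form.** Over any coefficient ring in which `ρ` is a unit:
`M w = 0` iff `h_w(α♯) ≡ 0 (mod Y^{ℓ+1})` (scaled variables `y = ρ²Y`).
[cite: Kaltofen1995, §2 Step L, §3 eq. (29)] -/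
theorem kMatrix_mulVec_eq_zero_iff_sharp (hm : (red P).Monic) (hdeg : (red P).natDegree = d)
    (hρ : IsUnit (rhoR P d)) (ℓ : ℕ) (w : Fin d × Fin (e + 1) × Fin d → A) :
    (kMatrix P d e K hm ℓ).mulVec w = 0 ↔
      (X : (Rt P)[X]) ^ (ℓ + 1) ∣ ((smallPoly P d e w).map (scaleY P d)).eval (alphaSharp P d e K) := by
  rw [X_pow_dvd_iff, funext_iff]
  simp only [Pi.zero_apply, coeff_eval_smallPoly_sharp]
  constructor
  · intro h k hk
    suffices hz : ∑ c, algebraMap A (Rt P) (w c) *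
        entryR P d e K k ((c.1 : ℕ), (c.2.1 : ℕ), (c.2.2 : ℕ)) = 0 by rw [hz, mul_zero]
    rw [eq_zero_iff_coeff_modByMonicHom hm hdeg]
    intro j
    rw [← kMatrix_mulVec hm ℓ w (⟨k, hk⟩, j)]
    exact h _
  · rintro h ⟨⟨k, hk⟩, j⟩
    have hk' := h k hk
    have hu : IsUnit (if k = 0 then (1 : Rt P) else rhoR P d) := by
      split_ifs
      · exact isUnit_one
      · exact hρ
    rw [hu.mul_right_eq_zero, eq_zero_iff_coeff_modByMonicHom hm hdeg] at hk'
    rw [kMatrix_mulVec]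
    exact hk' j

end Matrix29

/-! ### Over a field: back to the true variable `y = ρ² Y` -/

section FieldScale

variable {K : Type u} [Field K] {P : Polynomial K[X]} {d e K' : ℕ}

/-- `unscaleY ∘ scaleY = id` for `ρ ≠ 0`. [folklore] -/
theorem unscaleY_scaleY (hρ : rres P d ≠ 0) (p : (Rt P)[X]) : unscaleY P d (scaleY P d p) = p := by
  rw [coe_compRingHom_apply, coe_compRingHom_apply, comp_assoc, mul_comp, C_comp, X_comp, ← mul_assoc,
    ← C_mul, rhoR, ← map_pow, ← map_mul, ← mul_pow, mul_inv_cancel₀ hρ, one_pow, map_one, C_1,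
    one_mul, comp_X]

/-- `scaleY ∘ unscaleY = id` for `ρ ≠ 0`. [folklore] -/
theorem scaleY_unscaleY (hρ : rres P d ≠ 0) (p : (Rt P)[X]) : scaleY P d (unscaleY P d p) = p := by
  rw [coe_compRingHom_apply, coe_compRingHom_apply, comp_assoc, mul_comp, C_comp, X_comp, ← mul_assoc,
    ← C_mul, rhoR, ← map_pow, ← map_mul, ← mul_pow, inv_mul_cancel₀ hρ, one_pow, map_one, C_1,
    one_mul, comp_X]

/-- Scalings preserve divisibility by powers of the variable. [folklore] -/
theorem X_pow_dvd_comp_C_mul_X {B : Type*} [CommSemiring B] {p : B[X]} {n : ℕ} (b : B)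
    (h : (X : B[X]) ^ n ∣ p) : (X : B[X]) ^ n ∣ p.comp (C b * X) := by
  obtain ⟨q, rfl⟩ := h
  rw [mul_comp, X_pow_comp, mul_pow, mul_assoc, mul_left_comm]
  exact Dvd.intro _ rfl

/-- Evaluation in the true variable versus the scaled one: `Q(α_K) = unscale(Q♯(α♯_K))`.
[folklore] -/
theorem eval_alphaTrue (hρ : rres P d ≠ 0) (Q : Polynomial (Rt P)[X]) :
    Q.eval (alphaTrue P d e K') = unscaleY P d ((Q.map (scaleY P d)).eval (alphaSharp P d e K')) := by
  have hid : (unscaleY P d).comp (scaleY P d) = RingHom.id _ := RingHom.ext (unscaleY_scaleY hρ)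
  rw [alphaTrue, ← eval_map_apply, Polynomial.map_map, hid, Polynomial.map_id]

/-- Divisibility by `y^n` in the true variable iff by `Y^n` in the scaled one. [folklore] -/
theorem X_pow_dvd_eval_alphaTrue_iff (hρ : rres P d ≠ 0) (Q : Polynomial (Rt P)[X]) (n : ℕ) :
    (X : (Rt P)[X]) ^ n ∣ Q.eval (alphaTrue P d e K') ↔
      (X : (Rt P)[X]) ^ n ∣ (Q.map (scaleY P d)).eval (alphaSharp P d e K') := by
  rw [eval_alphaTrue hρ]
  refine ⟨fun h => ?_, fun h => X_pow_dvd_comp_C_mul_X _ h⟩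
  have := X_pow_dvd_comp_C_mul_X (rhoR P d ^ 2) h
  rwa [← coe_compRingHom_apply, scaleY_unscaleY hρ] at this

/-- **The approximate root:** `P(α_K, y) ≡ 0 (mod y^{K+1})` in `R[y]` (`P` of `x`-degree `≤ d`,
`d ≥ 1`, `y`-degree `≤ e`, `ρ ≠ 0`). [cite: Kaltofen1995, §2 Step N] -/
theorem X_pow_dvd_eval_alphaTrue (hρ : rres P d ≠ 0) (hd : d ≠ 0) (hP : P.natDegree ≤ d)
    (hPe : ∀ k, (P.coeff k).natDegree ≤ e) :
    (X : (Rt P)[X]) ^ (K' + 1) ∣ (liftR P).eval (alphaTrue P d e K') := by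
  rw [X_pow_dvd_eval_alphaTrue_iff hρ]
  exact X_pow_dvd_eval_sharpP_alphaSharp P d e hd hP hPe K'

/-- **Kaltofen's linear system (29) ⟺ `h_w(α) ≡ 0 (mod y^{ℓ+1})`** (over a field, `ρ ≠ 0`,
`P(x,0)` monic of degree `d`): the vector `w` of coefficients of a candidate
`h_w = Σ w_{i,l,ι} z̄^ι yˡ xⁱ` solves `M w = 0` iff `h_w` vanishes on the approximate root to order
`ℓ + 1`. [cite: Kaltofen1995, §2 Step L, §3 eq. (29)] -/
theorem kMatrix_mulVec_eq_zero_iff (hm : (red P).Monic) (hdeg : (red P).natDegree = d)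
    (hρ : rres P d ≠ 0) (ℓ : ℕ) (w : Fin d × Fin (e + 1) × Fin d → K) :
    (kMatrix P d e K' hm ℓ).mulVec w = 0 ↔
      (X : (Rt P)[X]) ^ (ℓ + 1) ∣ (smallPoly P d e w).eval (alphaTrue P d e K') := by
  rw [X_pow_dvd_eval_alphaTrue_iff hρ]
  exact kMatrix_mulVec_eq_zero_iff_sharp hm hdeg ((Ne.isUnit hρ).map _) ℓ w

end FieldScale

/-! ### Functoriality in the coefficient ring -/

section Functorial

/-- Coefficients of the first component of `adjSylvester f g x` are entries of
`adj(Syl(f,g)) · (coefficients of x)`. [folklore] -/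
theorem coeff_adjSylvester_fst {R : Type*} [CommRing R] {m n : ℕ} (f g : R[X])
    (x : degreeLT R (m + n)) (i : Fin m) :
    ((adjSylvester f g x).1 : R[X]).coeff i =
      ((sylvester f g m n).adjugate.mulVec fun j => (x : R[X]).coeff j) (Fin.castAdd n i) := by
  have h := Matrix.repr_toLin (v₁ := degreeLT.basis R (m + n))
    (v₂ := ((degreeLT.basis R m).prod (degreeLT.basis R n)).reindex finSumFinEquiv)
    (sylvester f g m n).adjugate x
  have h' := congrFun h (finSumFinEquiv (Sum.inl i))
  rw [Module.Basis.repr_reindex_apply, Equiv.symm_apply_apply, Module.Basis.prod_repr_inl,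
    degreeLT.basis_repr] at h'
  rw [finSumFinEquiv_apply_left] at h'
  rw [adjSylvester, h']
  rfl

/-- Beyond `m` the first component of `adjSylvester f g x` has no coefficients. [folklore] -/
theorem coeff_adjSylvester_fst_eq_zero {R : Type*} [CommRing R] {m n : ℕ} (f g : R[X])
    (x : degreeLT R (m + n)) {i : ℕ} (hi : m ≤ i) :
    ((adjSylvester f g x).1 : R[X]).coeff i = 0 := by
  refine coeff_eq_zero_of_degree_lt (lt_of_lt_of_le (mem_degreeLT.1 (adjSylvester f g x).1.2) ?_)
  exact_mod_cast hi

variable {B : Type v} [CommRing B] (φ : A →+* B) (P : Polynomial A[X]) (d e K : ℕ)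

/-- `ρ` commutes with base change. [folklore] -/
theorem rres_mapP : rres (mapP φ P) d = φ (rres P d) := by
  rw [rres, rres, red_mapP, derivative_map, resultant_map_map]

/-- The cofactor polynomial commutes with base change. [folklore] -/
theorem cofPoly_mapP : cofPoly (mapP φ P) d = (cofPoly P d).map φ := by
  unfold cofPoly
  split_ifs with hd
  · rw [Polynomial.map_zero]
  · ext i
    rw [coeff_map]
    by_cases hi : i < d
    · rw [coeff_adjSylvester_fst _ _ _ ⟨i, hi⟩, coeff_adjSylvester_fst _ _ _ ⟨i, hi⟩, RingHom.map_mulVec,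
        ← RingHom.mapMatrix_apply, RingHom.map_adjugate, ← sylvester_map_map, ← derivative_map,
        ← red_mapP]
      congr 1
      funext j
      simp only [Function.comp_apply, coeff_one, apply_ite φ, map_one, map_zero]
    · rw [coeff_adjSylvester_fst_eq_zero _ _ _ (not_lt.1 hi),
        coeff_adjSylvester_fst_eq_zero _ _ _ (not_lt.1 hi), map_zero]

/-- `spec z̄ = z̄`. [folklore] -/
@[simp] theorem spec_zbar : spec φ P (zbar P) = zbar (mapP φ P) := by
  rw [spec, AdjoinRoot.map_root]

/-- `spec` on constants. [folklore] -/
@[simp] theorem spec_algebraMap (a : A) :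
    spec φ P (algebraMap A (Rt P) a) = algebraMap B (Rt (mapP φ P)) (φ a) := by
  rw [spec, AdjoinRoot.algebraMap_eq, AdjoinRoot.map_of, AdjoinRoot.algebraMap_eq]

/-- `spec` on constants (`AdjoinRoot.of` form). [folklore] -/
@[simp] theorem spec_of (a : A) :
    spec φ P (AdjoinRoot.of (red P) a) = AdjoinRoot.of (red (mapP φ P)) (φ a) := by
  rw [spec, AdjoinRoot.map_of]

/-- `spec ∘ algebraMap A R = algebraMap B R' ∘ φ`. [folklore] -/
theorem spec_comp_algebraMap :
    (spec φ P).comp (algebraMap A (Rt P)) = (algebraMap B (Rt (mapP φ P))).comp φ :=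
  RingHom.ext (spec_algebraMap φ P)

/-- `spec (p(z̄)) = (φp)(z̄)`. [folklore] -/
@[simp] theorem spec_mk (p : A[X]) :
    spec φ P (AdjoinRoot.mk (red P) p) = AdjoinRoot.mk (red (mapP φ P)) (p.map φ) := by
  rw [spec, AdjoinRoot.map, AdjoinRoot.lift_mk, ← eval₂_map, ← AdjoinRoot.algebraMap_eq, ← aeval_def,
    AdjoinRoot.aeval_eq]

/-- `ρ ∈ R` under base change. [folklore] -/
@[simp] theorem spec_rhoR : spec φ P (rhoR P d) = rhoR (mapP φ P) d := by
  change spec φ P (algebraMap A (Rt P) (rres P d)) = algebraMap B (Rt (mapP φ P)) (rres (mapP φ P) d)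
  rw [spec_algebraMap, rres_mapP]

/-- `r ∈ R` under base change. [folklore] -/
@[simp] theorem spec_cof : spec φ P (cof P d) = cof (mapP φ P) d := by
  rw [cof, spec_mk, cof, cofPoly_mapP]

/-- `P₀'(z̄)` under base change. [folklore] -/
@[simp] theorem spec_der0 : spec φ P (der0 P) = der0 (mapP φ P) := by
  rw [der0, spec_mk, der0]
  congr 1
  simp only [red_mapP, derivative_map]

/-- `liftR` under base change. [folklore] -/
theorem liftR_mapP : liftR (mapP φ P) = (liftR P).map (mapRingHom (spec φ P)) := by
  dsimp only [liftR, mapP]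
  rw [Polynomial.map_map, Polynomial.map_map, Polynomial.mapRingHom_comp,
    Polynomial.mapRingHom_comp, spec_comp_algebraMap]

/-- Taylor data under base change. [folklore] -/
@[simp] theorem tayl_mapP (i : ℕ) : tayl (mapP φ P) i = (tayl P i).map (spec φ P) := by
  have hC : C (zbar (mapP φ P)) = mapRingHom (spec φ P) (C (zbar P)) := by
    rw [coe_mapRingHom, map_C, spec_zbar]
  rw [tayl, tayl, liftR_mapP, hasseDeriv_map, hC, eval_map_apply, coe_mapRingHom]

/-- `G` under base change. [folklore] -/
theorem bigG_mapP : bigG (mapP φ P) d e = (bigG P d e).map (mapRingHom (spec φ P)) := by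
  rw [bigG, bigG, Polynomial.map_sum]
  refine Finset.sum_congr rfl fun i _ => ?_
  rw [Polynomial.map_sum]
  refine Finset.sum_congr rfl fun j _ => ?_
  split_ifs
  · rw [Polynomial.map_zero]
  · simp only [Polynomial.map_mul, Polynomial.map_pow, map_X, map_C, coe_mapRingHom, map_mul, map_pow,
      tayl_mapP, coeff_map, spec_rhoR]

/-- `F♮` under base change. [folklore] -/
theorem natF_mapP : natF (mapP φ P) d e = (natF P d e).map (mapRingHom (spec φ P)) := by
  rw [natF, natF, Polynomial.map_add, map_X, Polynomial.map_mul, map_C, coe_mapRingHom, map_C,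
    spec_cof, bigG_mapP]

/-- `δ̄` under base change. [folklore] -/
@[simp] theorem deltaBar_mapP : deltaBar (mapP φ P) d e K = (deltaBar P d e K).map (spec φ P) := by
  rw [deltaBar, deltaBar, natF_mapP, map_newtonSeq]

/-- `A_i` under base change. [folklore] -/
@[simp] theorem powA_mapP (i : ℕ) : powA (mapP φ P) d e K i = (powA P d e K i).map (spec φ P) := by
  induction i with
  | zero => simp [powA]
  | succ i ih =>
    rw [powA, powA, ih]
    simp only [Polynomial.map_add, Polynomial.map_mul, Polynomial.map_pow, map_C, map_pow, spec_zbar,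
      deltaBar_mapP, spec_rhoR]

/-- The entries `E_k(c)` under base change. [folklore] -/
@[simp] theorem spec_entryR (k : ℕ) (c : ℕ × ℕ × ℕ) :
    spec φ P (entryR P d e K k c) = entryR (mapP φ P) d e K k c := by
  unfold entryR
  split_ifs <;> simp [coeff_map, rhoR, rres_mapP, AdjoinRoot.algebraMap_eq]

/-- **Kaltofen's matrix is functorial:** `M(φP) = φ(M(P))`. [cite: Kaltofen1995, §3 (generic inputs)] -/
theorem kMatrix_mapP (hm : (red P).Monic) (hm' : (red (mapP φ P)).Monic) (ℓ : ℕ) :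
    kMatrix (mapP φ P) d e K hm' ℓ = (kMatrix P d e K hm ℓ).map φ := by
  ext r c
  rw [Matrix.map_apply, kMatrix, kMatrix, ← spec_entryR]
  obtain ⟨p, hp⟩ := AdjoinRoot.mk_surjective (entryR P d e K r.1 ((c.1 : ℕ), (c.2.1 : ℕ), (c.2.2 : ℕ)))
  rw [← hp, spec_mk, AdjoinRoot.modByMonicHom_mk, AdjoinRoot.modByMonicHom_mk, ← coeff_map,
    map_modByMonic φ hm, red_mapP]

end Functorial

end Literature.RingTheory.MvPolynomial.KaltofenAIT

end
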